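import Literature.AnabelianGeometry.EtaleTheta.Discharge.Sec2DescentLemmas
import Literature.AnabelianGeometry.EtaleTheta.Discharge.Sec2DiscreteRigidityProofs
import Literature.AnabelianGeometry.EtaleTheta.Discharge.Sec2AutOverProofs

/-!
# [EtTh] §2 discharge: reduction of `D_Y` and of `μ_N`-conjugacy classes along `M_{M'} → M_M`
# (lemmas for `ThetaEnvTower.Cor218_iv_reduction`)

Mochizuki, *The Étale Theta Function and its Frobenioid-theoretic Manifestations* [EtTh],
Publ. RIMS 45 (2009), §2, Def 2.13 (i)–(ii) pp.47–48, Cor 2.18 (iv) pp.61–63 (locators `p.N` = PDF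
pages of the PRIMS text; bib key `MochizukiEtTh2009`). PROOF-ONLY companion (no `def`, no new named
fact; seat abc-iut-L2-d1, input-discharge for the hypothesis `Cor218_iv_reduction` of the Cor 2.19 (ii)
discharge) of `MonoThetaEnv.lean` / `ThetaSystems.lean` (seat abc-iut-L2-t2). Contents:

* (reused from abc-iut-L2-t10's `Sec2AutOverProofs`: `CycEnvelope.image_muConjClass_eq_of_perm` —
  an automorphism permuting the cyclotome carries `μ_N`-conjugacy classes to classes);
* `ThetaEnvTower.exists_reduces_contMulAut` — under Cor 2.18 (iii) (`Ker(Π• ↠ Π•_Y)` = union of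
  centralisers) EVERY automorphism of the topological group `Π^tp_Y[μ_{M'}]` reduces to `Π^tp_Y[μ_M]`;
* `ThetaEnvTower.mk_mem_DY_of_reduces` — the reduction of (a representative of) an element of
  `D_Y ⊆ Out(Π^tp_Y[μ_{M'}])` represents an element of `D_Y ⊆ Out(Π^tp_Y[μ_M])` (Kummer shifts reduce to
  Kummer shifts, `Gal(Y/X)`-conjugations to themselves, inner to inner).

HONEST FRAMING: no side is taken on [IUTchIII] Cor 3.12; typed ≠ discharged elsewhere.
-/

namespace Literature.AnabelianGeometry.EtaleTheta

universe u


namespace ThetaEnvTower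

variable {E : Set ℕ+} (T : ThetaEnvTower.{u} E)

/-- Under Cor 2.18 (iii) (`Ker(Π• ↠ Π•_Y)` = union of centralisers of open subgroups) every
automorphism of the topological group `Π^tp_Y[μ_M]` preserves the cyclotome.
[cite: MochizukiEtTh2009, Cor 2.18(iii) p.61] -/
theorem map_ker_eq_of_contMulAut (M : E)
    (hq : centralizerUnion (T.level M).env = (CycEnvelope.proj (T.level M).augY (T.level M).chi).ker)
    (φ : contMulAut (T.level M).env) :
    ((CycEnvelope.proj (T.level M).augY (T.level M).chi).ker).map (φ : MulAut (T.level M).env).toMonoidHom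
      = (CycEnvelope.proj (T.level M).augY (T.level M).chi).ker := by
  rw [← hq]
  exact map_centralizerUnion_eq (ContinuousMulEquiv.mk (φ : MulAut (T.level M).env) φ.2.1 φ.2.2)

variable {T}

/-- Every automorphism of the topological group `Π^tp_Y[μ_{M'}]` reduces to one of `Π^tp_Y[μ_M]`
(under Cor 2.18 (iii) at level `M'`). [cite: MochizukiEtTh2009, Cor 2.18(iv) p.61] -/
theorem exists_reduces_contMulAut {M M' : E} (h : (M : ℕ+) ∣ M')
    (hq' : centralizerUnion (T.level M').env =
      (CycEnvelope.proj (T.level M').augY (T.level M').chi).ker)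
    (φ : contMulAut (T.level M').env) :
    ∃ ψ : contMulAut (T.level M).env,
      T.Reduces h (φ : MulAut (T.level M').env) (ψ : MulAut (T.level M).env) := by
  obtain ⟨ψ, hψ⟩ := T.exists_reduces h
    (ContinuousMulEquiv.mk (φ : MulAut (T.level M').env) φ.2.1 φ.2.2) (T.map_ker_eq_of_contMulAut M' hq' φ)
  exact ⟨⟨ψ.toMulEquiv, ψ.continuous, ψ.symm.continuous⟩, hψ⟩

/-- If `[φ] = [θ]` in `Out` then `φ = θ ∘ conj(y)` for some `y`.
[cite: MochizukiEtTh2009, Def 2.13(i) p.47] -/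
theorem exists_eq_mul_conj_of_mk_eq {A : Type*} [Group A] [TopologicalSpace A]
    {φ θ : contMulAut A} (hφ : TopOut.mk _ φ = TopOut.mk _ θ) :
    ∃ y : A, (φ : MulAut A) = (θ : MulAut A) * MulAut.conj y := by
  obtain ⟨z, hz, hzeq⟩ := (QuotientGroup.mk'_eq_mk' _).mp hφ
  obtain ⟨y, hy⟩ := MonoidHom.mem_range.mp (Subgroup.mem_subgroupOf.mp hz)
  refine ⟨y⁻¹, ?_⟩
  rw [map_inv, hy, ← Subgroup.coe_inv, ← Subgroup.coe_mul, ← hzeq, mul_inv_cancel_right]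

/-- **Reduction of `D_Y`**: if `φ'` represents an element of `D_Y ⊆ Out(Π^tp_Y[μ_{M'}])` and `ψ` is an
automorphism of the topological group `Π^tp_Y[μ_M]` with `red ∘ φ' = ψ ∘ red`, then `ψ` represents an
element of `D_Y ⊆ Out(Π^tp_Y[μ_M])`. [cite: MochizukiEtTh2009, Cor 2.18(iv) p.61] -/
theorem mk_mem_DY_of_reduces {M M' : E} (h : (M : ℕ+) ∣ M')
    (hq' : centralizerUnion (T.level M').env =
      (CycEnvelope.proj (T.level M').augY (T.level M').chi).ker)
    (φ' : contMulAut (T.level M').env) (hφ' : TopOut.mk _ φ' ∈ (T.level M').DY)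
    (ψ : contMulAut (T.level M).env)
    (hψ : T.Reduces h (φ' : MulAut (T.level M').env) (ψ : MulAut (T.level M).env)) :
    TopOut.mk _ ψ ∈ (T.level M).DY := by
  haveI := (T.level M).isTopologicalGroup_env
  -- inner automorphisms at level `M` are bi-continuous and trivial in `Out`
  have hinn : ∀ y : (T.level M).env, MulAut.conj y ∈ contMulAut (T.level M).env := fun y =>
    innerAut_le_contMulAut _ ⟨y, rfl⟩
  have hinn1 : ∀ y : (T.level M).env, TopOut.mk _ ⟨MulAut.conj y, hinn y⟩ = 1 := fun y =>
    (QuotientGroup.eq_one_iff _).mpr (Subgroup.mem_subgroupOf.mpr ⟨y, rfl⟩)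
  -- if `ψ = θ ∘ conj(y)` with `θ` bi-continuous, then `[ψ] = [θ]`
  have hfac : ∀ (ψ : contMulAut (T.level M).env) (θ : MulAut (T.level M).env) (y : (T.level M).env),
      (ψ : MulAut (T.level M).env) = θ * MulAut.conj y →
      ∃ hθ : θ ∈ contMulAut (T.level M).env, TopOut.mk _ ψ = TopOut.mk _ ⟨θ, hθ⟩ := by
    intro ψ θ y hψθ
    have hθ : θ ∈ contMulAut (T.level M).env := by
      have : θ = (ψ : MulAut (T.level M).env) * (MulAut.conj y)⁻¹ := by
        rw [hψθ, mul_inv_cancel_right]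
      rw [this]
      exact Subgroup.mul_mem _ ψ.2 (Subgroup.inv_mem _ (hinn y))
    refine ⟨hθ, ?_⟩
    have : ψ = ⟨θ, hθ⟩ * ⟨MulAut.conj y, hinn y⟩ := Subtype.ext hψθ
    rw [this, map_mul, hinn1, mul_one]
  revert ψ
  have key : ∀ d' ∈ (T.level M').DY, ∀ φ' : contMulAut (T.level M').env, TopOut.mk _ φ' = d' →
      ∀ ψ : contMulAut (T.level M).env,
        T.Reduces h (φ' : MulAut (T.level M').env) (ψ : MulAut (T.level M).env) →
        TopOut.mk _ ψ ∈ (T.level M).DY := by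
    intro d' hd'
    refine Subgroup.closure_induction (p := fun d' _ => ∀ φ' : contMulAut (T.level M').env,
      TopOut.mk _ φ' = d' → ∀ ψ : contMulAut (T.level M).env,
        T.Reduces h (φ' : MulAut (T.level M').env) (ψ : MulAut (T.level M).env) →
        TopOut.mk _ ψ ∈ (T.level M).DY) ?_ ?_ ?_ ?_ hd'
    · rintro d' (⟨δ, hδ, hc, rfl⟩ | ⟨g, hc, rfl⟩) φ' hφ' ψ hψ
      · -- a Kummer shift: reduces to the Kummer shift by the reduced cocycle
        obtain ⟨y, hy⟩ := exists_eq_mul_conj_of_mk_eq hφ'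
        have hred : T.Reduces h (φ' : MulAut (T.level M').env)
            (CycEnvelope.shift (T.isEnvCocycle_red_comp h hδ) * MulAut.conj (T.redEnv M M' h y)) := by
          rw [hy]
          exact reduces_mul (T.reduces_shift h hδ) (T.reduces_conj h y)
        obtain ⟨hθ, hmk⟩ := hfac ψ _ _ (reduces_unique hψ hred)
        rw [hmk]
        exact Subgroup.subset_closure (Set.mem_union_left _
          ⟨T.red M M' h ∘ δ, T.isEnvCocycle_red_comp h hδ, hθ, rfl⟩)
      · -- a `Gal(Y/X)`-conjugation: reduces to itself
        obtain ⟨y, hy⟩ := exists_eq_mul_conj_of_mk_eq hφ'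
        have hred : T.Reduces h (φ' : MulAut (T.level M').env)
            ((T.level M).conjX g * MulAut.conj (T.redEnv M M' h y)) := by
          rw [hy]
          exact reduces_mul (T.reduces_conjX h g) (T.reduces_conj h y)
        obtain ⟨hθ, hmk⟩ := hfac ψ _ _ (reduces_unique hψ hred)
        rw [hmk]
        exact Subgroup.subset_closure (Set.mem_union_right _ ⟨g, hθ, rfl⟩)
    · intro φ' hφ' ψ hψ
      obtain ⟨y, hy⟩ := exists_eq_mul_conj_of_mk_eq (θ := 1) (by rw [hφ', map_one])
      have hred : T.Reduces h (φ' : MulAut (T.level M').env)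
          (1 * MulAut.conj (T.redEnv M M' h y)) := by
        rw [hy]
        exact reduces_mul reduces_one (T.reduces_conj h y)
      obtain ⟨hθ, hmk⟩ := hfac ψ _ _ (reduces_unique hψ hred)
      rw [hmk, show (⟨1, hθ⟩ : contMulAut (T.level M).env) = 1 from Subtype.ext rfl, map_one]
      exact (T.level M).DY.one_mem
    · intro d₁ d₂ _ _ h₁ h₂ φ' hφ' ψ hψ
      obtain ⟨φ₁, rfl⟩ := QuotientGroup.mk'_surjective _ d₁
      obtain ⟨ψ₁, hψ₁⟩ := exists_reduces_contMulAut h hq' φ₁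
      obtain ⟨ψ₂, hψ₂⟩ := exists_reduces_contMulAut h hq' (φ₁⁻¹ * φ')
      have hm₁ := h₁ φ₁ rfl ψ₁ hψ₁
      have hm₂ := h₂ (φ₁⁻¹ * φ') (by rw [map_mul, map_inv, hφ', inv_mul_cancel_left]) ψ₂ hψ₂
      have hred : T.Reduces h (φ' : MulAut (T.level M').env)
          ((ψ₁ : MulAut (T.level M).env) * (ψ₂ : MulAut (T.level M).env)) := by
        have : (φ' : MulAut (T.level M').env) =
            (φ₁ : MulAut (T.level M').env) * ((φ₁⁻¹ * φ' : contMulAut (T.level M').env) :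
              MulAut (T.level M').env) := by
          rw [Subgroup.coe_mul, Subgroup.coe_inv, mul_inv_cancel_left]
        rw [this]
        exact reduces_mul hψ₁ hψ₂
      have : ψ = ψ₁ * ψ₂ := Subtype.ext (reduces_unique hψ hred)
      rw [this, map_mul]
      exact (T.level M).DY.mul_mem hm₁ hm₂
    · intro d _ hd φ' hφ' ψ hψ
      have hm := hd φ'⁻¹ (by rw [map_inv, hφ', inv_inv]) ψ⁻¹ (by
        rw [Subgroup.coe_inv, Subgroup.coe_inv]
        exact reduces_inv hψ)
      rwa [map_inv, inv_mem_iff] at hm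
  exact fun ψ hψ => key _ hφ' φ' rfl ψ hψ

end ThetaEnvTower

end Literature.AnabelianGeometry.EtaleTheta
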